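import Literature.Probability.LatticeModels.MedialTrailUmlaufsatz

/-!
# Winding numbers of closed UNIT-STEP polygons in medial coordinates: jumps across steps

`MedialTrailUmlaufsatz` defines the combinatorial winding number `MedialTrail.wnd l F` of a
cyclic vertex list `l` around the face `F` (horizontal-ray count of the vertical steps) and proves
its jump `wnd l (lf d) - wnd l (rf d) = (cdarts l).count d` across a dart `d` for CLOSED WALKS OF
THE ORIENTED MEDIAL GRAPH (`∀ e ∈ cdarts l, IsDart e.1 e.2`). The height representation of level
lines with prescribed boundary data (insertion dictionary of `CollarLegModel`, crux
`BoundaryDefectGaussianR`) closes an oriented strand by an arc of the rim of the cell region, which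
is traversed partly AGAINST the medial orientation; this file records that the jump identities hold
for every closed polygon of axis-parallel UNIT STEPS (`IsUnitStep`), oriented or not:

* `unitStep_flux` — the per-step Kirchhoff identity (no parity hypothesis);
* `dwnd_sub_south_add_of_unitStep`, `wnd_sub_south_of_unitStep` — the jump across a horizontal
  segment is the signed number of steps on it;
* `wnd_lf_sub_rf_of_unitStep` — **across any unit step `d`, `wnd l (lf d) - wnd l (rf d)` is the
  number of occurrences of `d` minus the number of occurrences of the reversed step** (for an
  oriented trail the reversed step never occurs and this is `IsTrail.wnd_lf`).

The vertical jump `wnd_sub_west` of the tree is already hypothesis-free. [folklore]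
-/

namespace Literature.Probability.LatticeModels.MedialTrail

variable {l : List Pt}

/-- A unit axis-parallel step (a dart of the medial graph or its reverse). [folklore] -/
def IsUnitStep (p q : Pt) : Prop :=
  (q.1 = p.1 ∧ (q.2 = p.2 + 1 ∨ q.2 = p.2 - 1)) ∨ (q.2 = p.2 ∧ (q.1 = p.1 + 1 ∨ q.1 = p.1 - 1))

/-- Being a unit step is decidable. [folklore] -/
instance (p q : Pt) : Decidable (IsUnitStep p q) := by unfold IsUnitStep; infer_instance

/-- A dart is a unit step. [folklore] -/
theorem IsDart.isUnitStep {p q : Pt} (h : IsDart p q) : IsUnitStep p q := by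
  rcases h with ⟨-, h1, h2⟩ | ⟨-, h1, h2⟩
  · exact Or.inl ⟨h1, h2⟩
  · exact Or.inr ⟨h1, h2⟩

/-- The reverse of a unit step is a unit step. [folklore] -/
theorem IsUnitStep.symm {p q : Pt} (h : IsUnitStep p q) : IsUnitStep q p := by
  unfold IsUnitStep at h ⊢; omega

/-- The four kinds of unit steps, in coordinates. [folklore] -/
theorem IsUnitStep.cases {d : Pt × Pt} (hd : IsUnitStep d.1 d.2) :
    ∃ a b : ℤ, d = ((a, b), (a, b + 1)) ∨ d = ((a, b), (a, b - 1)) ∨ d = ((a, b), (a + 1, b)) ∨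
      d = ((a, b), (a - 1, b)) := by
  obtain ⟨⟨a, b⟩, ⟨c, e⟩⟩ := d
  simp only [IsUnitStep] at hd
  refine ⟨a, b, ?_⟩
  simp only [Prod.mk.injEq, true_and]
  omega

/-- Per-step flux identity across a horizontal segment (no orientation hypothesis): the flux of a
unit step out of the vertex set `{(x', y) : x' ≤ x}` is its winding-number jump between the faces
`(x, y)` and `(x, y - 1)`, corrected by the steps on the segment from `(x, y)` to `(x + 1, y)`. [folklore] -/
theorem unitStep_flux (d : Pt × Pt) (hd : IsUnitStep d.1 d.2) (x y : ℤ) :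
    rowInd x y d.2 - rowInd x y d.1 = (dartWnd d (x, y) - dartWnd d (x, y - 1)) -
      (if d = ((x, y), (x + 1, y)) then 1 else 0) + (if d = ((x + 1, y), (x, y)) then 1 else 0) := by
  obtain ⟨⟨a, b⟩, ⟨c, e⟩⟩ := d
  simp only [IsUnitStep] at hd
  simp only [dartWnd, rowInd, Prod.mk.injEq]
  rcases hd with ⟨hc, he | he⟩ | ⟨he, hc | hc⟩ <;> subst hc <;> subst he <;>
    · split_ifs <;> omega

/-- Flux form of the horizontal jump, for a list of unit steps. [folklore] -/
theorem dwnd_sub_south_add_of_unitStep (D : List (Pt × Pt)) (hD : ∀ d ∈ D, IsUnitStep d.1 d.2) (x y : ℤ) :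
    dwnd D (x, y) - dwnd D (x, y - 1) = D.count ((x, y), (x + 1, y)) - D.count ((x + 1, y), (x, y)) +
      (D.map fun d => rowInd x y d.2 - rowInd x y d.1).sum := by
  induction D with
  | nil => simp
  | cons d D ih =>
    simp only [dwnd_cons, List.count_cons, beq_iff_eq, List.map_cons, List.sum_cons]
    have h1 := unitStep_flux d (hD d (by simp)) x y
    have h2 := ih (fun e he => hD e (by simp [he]))
    push_cast
    omega

/-- **Jump across a horizontal segment** for a closed polygon of unit steps: the faces `(x, y)`
and `(x, y - 1)` are separated by the segment from `(x, y)` to `(x + 1, y)`; the winding number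
jumps by the signed number of steps on it. [folklore] -/
theorem wnd_sub_south_of_unitStep (hl : ∀ d ∈ cdarts l, IsUnitStep d.1 d.2) (x y : ℤ) :
    wnd l (x, y) - wnd l (x, y - 1) =
      (cdarts l).count ((x, y), (x + 1, y)) - (cdarts l).count ((x + 1, y), (x, y)) := by
  have := dwnd_sub_south_add_of_unitStep (cdarts l) hl x y
  rw [sum_cdarts_sub l (rowInd x y), add_zero] at this
  exact this

/-- **Jump across a unit step of a closed unit-step polygon**: from the face on the left of the
step `d` to the face on its right the winding number drops by the number of occurrences of `d`
minus the number of occurrences of the reversed step. [folklore] -/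
theorem wnd_lf_sub_rf_of_unitStep (hl : ∀ e ∈ cdarts l, IsUnitStep e.1 e.2) {d : Pt × Pt}
    (hd : IsUnitStep d.1 d.2) :
    wnd l (lf d) - wnd l (rf d) = (cdarts l).count d - (cdarts l).count d.swap := by
  obtain ⟨a, b, rfl | rfl | rfl | rfl⟩ := hd.cases
  · -- north
    have h1 := wnd_sub_west l a b
    rw [lf_north, rf_north]
    simp only [Prod.swap_prod_mk]
    linarith
  · -- south
    have h1 := wnd_sub_west l a (b - 1)
    simp only [sub_add_cancel] at h1
    rw [lf_south, rf_south]
    simp only [Prod.swap_prod_mk]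
    linarith
  · -- east
    have h1 := wnd_sub_south_of_unitStep hl a b
    rw [lf_east, rf_east]
    simp only [Prod.swap_prod_mk]
    linarith
  · -- west
    have h1 := wnd_sub_south_of_unitStep hl (a - 1) b
    simp only [sub_add_cancel] at h1
    rw [lf_west, rf_west]
    simp only [Prod.swap_prod_mk]
    linarith

/-- Across a unit step that occurs once and whose reverse does not occur (e.g. a dart of an
oriented strand closed by a rim arc whose steps all border a non-cell), the winding number drops
by exactly one from left to right. [folklore] -/
theorem wnd_lf_of_count_eq_one (hl : ∀ e ∈ cdarts l, IsUnitStep e.1 e.2) {d : Pt × Pt}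
    (hd : IsUnitStep d.1 d.2) (h1 : (cdarts l).count d = 1) (h0 : (cdarts l).count d.swap = 0) :
    wnd l (lf d) = wnd l (rf d) + 1 := by
  have := wnd_lf_sub_rf_of_unitStep hl hd
  rw [h1, h0] at this
  omega

/-- Across a unit step such that neither it nor its reverse occurs in the polygon the winding
number does not jump. [folklore] -/
theorem wnd_lf_eq_rf_of_count_eq_zero (hl : ∀ e ∈ cdarts l, IsUnitStep e.1 e.2) {d : Pt × Pt}
    (hd : IsUnitStep d.1 d.2) (h1 : (cdarts l).count d = 0) (h0 : (cdarts l).count d.swap = 0) :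
    wnd l (lf d) = wnd l (rf d) := by
  have := wnd_lf_sub_rf_of_unitStep hl hd
  rw [h1, h0] at this
  omega

end Literature.Probability.LatticeModels.MedialTrail
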